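import Literature.MathematicalPhysics.QuantumLattice.HubbardTTPrimeGrandCanonicalThermalStatesEntropyRow
import HarnessLib

/-!
# Grand-canonical certificates ⇒ words for thermal grand-canonical states: the reader's entry points

Family `hubbard` (topic `MathematicalPhysics/QuantumLattice`). The one-call forms of the series
`HubbardTTPrimeGrandCanonical{GibbsMixture,ThermalStates,…,EntropyRow}` for a `T > 0` certifier: its inputs are
log-partition-function CERTIFICATES in the `K_L` spelling (`K_L = gcTorusHamiltonianTT' L t t' U μ h = H_L − μN − hM` on the
square torus `FermionTorus 2 L`), in the eventual shape of the tree's certificate readers — a FLOOR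
`∀ ε > 0, ∀ᶠ j, (W − ε)(L_j)² ≤ log Re Z_β(K_{L_j})` or a CEILING `∀ ε > 0, ∀ᶠ j, log Re Z_β(K_{L_j}) ≤ (q + ε)(L_j)²` along
any divergent side sequence; its outputs are words for EVERY thermal grand-canonical state `ω` at the anchor:

* `gcPressureTT'Zeeman_le_of_eventually_gcTorus` / `le_gcPressureTT'Zeeman_of_eventually_gcTorus` — certificates bind the
  number `P = gcPressureTT'Zeeman β t t' U μ h` (square-torus bridge `partitionFn_gcTorusHamiltonianTT'_re_eq_rect`);
* `IsTorusLimitOfMixture.density_mem_Icc_of_gc_certificates_of_gcGibbs` — a floor at `μ` and ceilings at `μ ± δ` give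
  `(W − q₋)/(βδ) ≤ ρ(ω) ≤ (q₊ − W)/(βδ)`; `…magnetisation_…` (field `h ± δ`), `…docc_…` (`U ± δ`, `δ ≤ U`:
  `(W − q₊)/(βδ) ≤ D(ω) ≤ (q₋ − W)/(βδ)`), `…energy_…` (`β ± δ`, `δ ≤ β`: `(W − q₊)/δ ≤ u(ω) ≤ (q₋ − W)/δ`);
* `IsTorusLimitOfMixture.mul_add_mul_energy_sub_log_le_re_expect_of_gc_certificate_of_gcGibbs` — the ENTROPY ROW with a
  floor certificate: `|B|·(W + β u(ω)) − log Re Tr e^{−G} ≤ Re ω_B(G)` for every rectangle `B` and witness `G`.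

Everything is PROVED (compositions of the series with the certificate dictionary); no definition, no named fact, no
sorry. WHAT THIS IS NOT: a certificate or a number of record — the file only says what a certificate buys.

## Mathlib / tree search

REUSED: `gcPressureTT'Zeeman_le_of_eventually`, `le_gcPressureTT'Zeeman_of_eventually` (`HubbardTTPrimeGrandCanonicalPressureZeeman`),
`partitionFn_gcTorusHamiltonianTT'_re_eq_rect` (`…GibbsMixture`), `IsTorusLimitOfMixture.{density,magnetisation,docc,energy}_mem_Icc_of_gc_bounds_of_gcGibbs`
(`…ThermalStates`), `IsTorusLimitOfMixture.gcPressureTT'Zeeman_add_mul_energy_le_of_gcGibbs_box` (`…EntropyRow`).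

## References

* D. Ruelle, *Statistical Mechanics: Rigorous Results* (1969), §3.4. [cite: Ruelle1969, §3.4]
* R. B. Griffiths, J. Math. Phys. 5 (1964) 1215. [cite: Griffiths1964]
* R. B. Israel, *Convexity in the Theory of Lattice Gases* (1979), Lemma II.3.1, Thm. I.3.4. [cite: Israel1979, Lemma II.3.1]
* T. Koma, H. Tasaki, J. Stat. Phys. 76 (1994) 745, §1. [cite: KomaTasaki1994, §1]
-/

noncomputable section

namespace Literature.MathematicalPhysics.QuantumLattice

open Matrix Finset HubbardWave0 Literature.Probability.LatticeModels ThermodynamicLimit LiebThm1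
open _root_.Filter
open scoped _root_.Topology ComplexOrder BigOperators

namespace ThermodynamicLimit

section Certificates

variable {β : ℝ} (hβ : 0 ≤ β) (t t' : ℝ) {U : ℝ} (hU : 0 ≤ U) (μ hz : ℝ) {Ls : ℕ → ℕ} (hLs : Tendsto Ls atTop atTop)
include hβ hU hLs

/-- **A grand-canonical CEILING certificate in the `K_L` spelling bounds the number from above**: if along
`Ls → ∞`, for every `ε > 0` eventually `log Re Z_β(K_{Ls j}(t,t',U,μ,h)) ≤ (q + ε)(Ls j)²`, then `P(β;t,t',U;μ,h) ≤ q`.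
[cite: Ruelle1969, §3.4] -/
theorem gcPressureTT'Zeeman_le_of_eventually_gcTorus {q : ℝ}
    (hq : ∀ ε : ℝ, 0 < ε → ∀ᶠ j in atTop,
      Real.log (partitionFn β (gcTorusHamiltonianTT' (Ls j) t t' U μ hz)).re ≤ (q + ε) * ((Ls j : ℕ) : ℝ) ^ 2) :
    gcPressureTT'Zeeman β t t' U μ hz ≤ q := by
  refine gcPressureTT'Zeeman_le_of_eventually hβ t t' hU μ hz hLs fun ε hε => ?_
  filter_upwards [hq ε hε] with j hj
  rwa [← partitionFn_gcTorusHamiltonianTT'_re_eq_rect]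

/-- **A grand-canonical FLOOR certificate in the `K_L` spelling bounds the number from below**: if along
`Ls → ∞`, for every `ε > 0` eventually `(W − ε)(Ls j)² ≤ log Re Z_β(K_{Ls j})`, then `W ≤ P(β;t,t',U;μ,h)`.
[cite: Ruelle1969, §3.4] -/
theorem le_gcPressureTT'Zeeman_of_eventually_gcTorus {W : ℝ}
    (hW : ∀ ε : ℝ, 0 < ε → ∀ᶠ j in atTop,
      (W - ε) * ((Ls j : ℕ) : ℝ) ^ 2 ≤ Real.log (partitionFn β (gcTorusHamiltonianTT' (Ls j) t t' U μ hz)).re) :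
    W ≤ gcPressureTT'Zeeman β t t' U μ hz := by
  refine le_gcPressureTT'Zeeman_of_eventually hβ t t' hU μ hz hLs fun ε hε => ?_
  filter_upwards [hW ε hε] with j hj
  rwa [← partitionFn_gcTorusHamiltonianTT'_re_eq_rect]

end Certificates

end ThermodynamicLimit

namespace InfVolFermionState

section Words

variable {β : ℝ} (hβ : 0 ≤ β) (t t' : ℝ) {U : ℝ} (hU : 0 ≤ U) (μ hz : ℝ)
  {ω : InfVolFermionState 2} {Ls : ℕ → ℕ}
include hβ hU

/-- **DENSITY WORD FROM THREE GRAND-CANONICAL CERTIFICATES.** Let `ω` be a thermal grand-canonical state at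
`(β; t,t',U; μ,h)` along `Ls → ∞` (`β > 0`, `U ≥ 0`), and let three log-partition-function certificates be given
along (possibly different) divergent side sequences: a FLOOR `W` at `μ` and CEILINGS `q₊` at `μ + δ`, `q₋` at `μ − δ`
(`δ > 0`), each in the eventual form `∀ ε > 0, ∀ᶠ j, …`. Then
`(W − q₋)/(βδ) ≤ ρ(ω) ≤ (q₊ − W)/(βδ)`. [cite: Griffiths1964] [cite: Ruelle1969, §3.4] -/
theorem IsTorusLimitOfMixture.density_mem_Icc_of_gc_certificates_of_gcGibbs (hβ' : 0 < β)
    (hω : ω.IsTorusLimitOfMixture sourcedGibbsCount (gcGibbsWeightTT' β t t' U μ hz)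
      (gcGibbsVectorTT' t t' U μ hz) Ls)
    (hLs : Tendsto Ls atTop atTop) {δ W qlo qhi : ℝ} (hδ : 0 < δ)
    {Lz Lhi Llo : ℕ → ℕ} (hL0 : Tendsto Lz atTop atTop) (hLhi : Tendsto Lhi atTop atTop) (hLlo : Tendsto Llo atTop atTop)
    (hW : ∀ ε : ℝ, 0 < ε → ∀ᶠ j in atTop,
      (W - ε) * ((Lz j : ℕ) : ℝ) ^ 2 ≤ Real.log (partitionFn β (gcTorusHamiltonianTT' (Lz j) t t' U μ hz)).re)
    (hqhi : ∀ ε : ℝ, 0 < ε → ∀ᶠ j in atTop,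
      Real.log (partitionFn β (gcTorusHamiltonianTT' (Lhi j) t t' U (μ + δ) hz)).re ≤ (qhi + ε) * ((Lhi j : ℕ) : ℝ) ^ 2)
    (hqlo : ∀ ε : ℝ, 0 < ε → ∀ᶠ j in atTop,
      Real.log (partitionFn β (gcTorusHamiltonianTT' (Llo j) t t' U (μ - δ) hz)).re ≤ (qlo + ε) * ((Llo j : ℕ) : ℝ) ^ 2) :
    ω.density ∈ Set.Icc ((W - qlo) / (β * δ)) ((qhi - W) / (β * δ)) :=
  hω.density_mem_Icc_of_gc_bounds_of_gcGibbs hβ t t' hU μ hz hLs hβ' hδ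
    (le_gcPressureTT'Zeeman_of_eventually_gcTorus hβ t t' hU μ hz hL0 hW)
    (gcPressureTT'Zeeman_le_of_eventually_gcTorus hβ t t' hU (μ + δ) hz hLhi hqhi)
    (gcPressureTT'Zeeman_le_of_eventually_gcTorus hβ t t' hU (μ - δ) hz hLlo hqlo)

/-- **MAGNETISATION WORD FROM THREE GRAND-CANONICAL CERTIFICATES** (floor at `h`, ceilings at `h ± δ`):
`(W − q₋)/(βδ) ≤ m(ω) ≤ (q₊ − W)/(βδ)`. [cite: Griffiths1964] [cite: Ruelle1969, §3.4] -/
theorem IsTorusLimitOfMixture.magnetisation_mem_Icc_of_gc_certificates_of_gcGibbs (hβ' : 0 < β)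
    (hω : ω.IsTorusLimitOfMixture sourcedGibbsCount (gcGibbsWeightTT' β t t' U μ hz)
      (gcGibbsVectorTT' t t' U μ hz) Ls)
    (hLs : Tendsto Ls atTop atTop) {δ W qlo qhi : ℝ} (hδ : 0 < δ)
    {Lz Lhi Llo : ℕ → ℕ} (hL0 : Tendsto Lz atTop atTop) (hLhi : Tendsto Lhi atTop atTop) (hLlo : Tendsto Llo atTop atTop)
    (hW : ∀ ε : ℝ, 0 < ε → ∀ᶠ j in atTop,
      (W - ε) * ((Lz j : ℕ) : ℝ) ^ 2 ≤ Real.log (partitionFn β (gcTorusHamiltonianTT' (Lz j) t t' U μ hz)).re)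
    (hqhi : ∀ ε : ℝ, 0 < ε → ∀ᶠ j in atTop,
      Real.log (partitionFn β (gcTorusHamiltonianTT' (Lhi j) t t' U μ (hz + δ))).re ≤ (qhi + ε) * ((Lhi j : ℕ) : ℝ) ^ 2)
    (hqlo : ∀ ε : ℝ, 0 < ε → ∀ᶠ j in atTop,
      Real.log (partitionFn β (gcTorusHamiltonianTT' (Llo j) t t' U μ (hz - δ))).re ≤ (qlo + ε) * ((Llo j : ℕ) : ℝ) ^ 2) :
    (ω.expect ({0} : Finset (Site 2)) (nAt 0 (Finset.mem_singleton_self 0) 0)).re -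
        (ω.expect ({0} : Finset (Site 2)) (nAt 0 (Finset.mem_singleton_self 0) 1)).re ∈
      Set.Icc ((W - qlo) / (β * δ)) ((qhi - W) / (β * δ)) :=
  hω.magnetisation_mem_Icc_of_gc_bounds_of_gcGibbs hβ t t' hU μ hz hLs hβ' hδ
    (le_gcPressureTT'Zeeman_of_eventually_gcTorus hβ t t' hU μ hz hL0 hW)
    (gcPressureTT'Zeeman_le_of_eventually_gcTorus hβ t t' hU μ (hz + δ) hLhi hqhi)
    (gcPressureTT'Zeeman_le_of_eventually_gcTorus hβ t t' hU μ (hz - δ) hLlo hqlo)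

/-- **DOUBLE-OCCUPANCY WORD FROM THREE GRAND-CANONICAL CERTIFICATES** (floor at `U`, ceilings at `U ± δ`,
`0 < δ ≤ U`): `(W − q₊)/(βδ) ≤ D(ω) ≤ (q₋ − W)/(βδ)`. [cite: Griffiths1964] [cite: KomaTasaki1994, §1] -/
theorem IsTorusLimitOfMixture.docc_mem_Icc_of_gc_certificates_of_gcGibbs (hβ' : 0 < β)
    (hω : ω.IsTorusLimitOfMixture sourcedGibbsCount (gcGibbsWeightTT' β t t' U μ hz)
      (gcGibbsVectorTT' t t' U μ hz) Ls)
    (hLs : Tendsto Ls atTop atTop) {δ W qlo qhi : ℝ} (hδ : 0 < δ) (hδU : δ ≤ U)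
    {Lz Lhi Llo : ℕ → ℕ} (hL0 : Tendsto Lz atTop atTop) (hLhi : Tendsto Lhi atTop atTop) (hLlo : Tendsto Llo atTop atTop)
    (hW : ∀ ε : ℝ, 0 < ε → ∀ᶠ j in atTop,
      (W - ε) * ((Lz j : ℕ) : ℝ) ^ 2 ≤ Real.log (partitionFn β (gcTorusHamiltonianTT' (Lz j) t t' U μ hz)).re)
    (hqhi : ∀ ε : ℝ, 0 < ε → ∀ᶠ j in atTop,
      Real.log (partitionFn β (gcTorusHamiltonianTT' (Lhi j) t t' (U + δ) μ hz)).re ≤ (qhi + ε) * ((Lhi j : ℕ) : ℝ) ^ 2)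
    (hqlo : ∀ ε : ℝ, 0 < ε → ∀ᶠ j in atTop,
      Real.log (partitionFn β (gcTorusHamiltonianTT' (Llo j) t t' (U - δ) μ hz)).re ≤ (qlo + ε) * ((Llo j : ℕ) : ℝ) ^ 2) :
    (ω.expect ({0} : Finset (Site 2))
        (nAt 0 (Finset.mem_singleton_self 0) 0 * nAt 0 (Finset.mem_singleton_self 0) 1)).re ∈
      Set.Icc ((W - qhi) / (β * δ)) ((qlo - W) / (β * δ)) :=
  hω.docc_mem_Icc_of_gc_bounds_of_gcGibbs hβ t t' hU μ hz hLs hβ' hδ hδU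
    (le_gcPressureTT'Zeeman_of_eventually_gcTorus hβ t t' hU μ hz hL0 hW)
    (gcPressureTT'Zeeman_le_of_eventually_gcTorus hβ t t' (by linarith) μ hz hLhi hqhi)
    (gcPressureTT'Zeeman_le_of_eventually_gcTorus hβ t t' (by linarith) μ hz hLlo hqlo)

/-- **THERMAL ENERGY WORD FROM THREE GRAND-CANONICAL CERTIFICATES** (floor at `β`, ceilings at `β ± δ`,
`0 < δ ≤ β`): `(W − q₊)/δ ≤ u(ω) ≤ (q₋ − W)/δ`, `u(ω) = e_Φ(ω) − μρ(ω) − h m(ω)`. [cite: Griffiths1964] [cite: Israel1979, Thm. I.3.4] -/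
theorem IsTorusLimitOfMixture.energy_mem_Icc_of_gc_certificates_of_gcGibbs
    (hω : ω.IsTorusLimitOfMixture sourcedGibbsCount (gcGibbsWeightTT' β t t' U μ hz)
      (gcGibbsVectorTT' t t' U μ hz) Ls)
    (hLs : Tendsto Ls atTop atTop) {δ W qlo qhi : ℝ} (hδ : 0 < δ) (hδβ : δ ≤ β)
    {Lz Lhi Llo : ℕ → ℕ} (hL0 : Tendsto Lz atTop atTop) (hLhi : Tendsto Lhi atTop atTop) (hLlo : Tendsto Llo atTop atTop)
    (hW : ∀ ε : ℝ, 0 < ε → ∀ᶠ j in atTop,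
      (W - ε) * ((Lz j : ℕ) : ℝ) ^ 2 ≤ Real.log (partitionFn β (gcTorusHamiltonianTT' (Lz j) t t' U μ hz)).re)
    (hqhi : ∀ ε : ℝ, 0 < ε → ∀ᶠ j in atTop,
      Real.log (partitionFn (β + δ) (gcTorusHamiltonianTT' (Lhi j) t t' U μ hz)).re ≤ (qhi + ε) * ((Lhi j : ℕ) : ℝ) ^ 2)
    (hqlo : ∀ ε : ℝ, 0 < ε → ∀ᶠ j in atTop,
      Real.log (partitionFn (β - δ) (gcTorusHamiltonianTT' (Llo j) t t' U μ hz)).re ≤ (qlo + ε) * ((Llo j : ℕ) : ℝ) ^ 2) :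
    ω.meanEnergy (hubbardTTPrimeFermionInteraction t t' U) 1 - μ * ω.density -
        hz * ((ω.expect ({0} : Finset (Site 2)) (nAt 0 (Finset.mem_singleton_self 0) 0)).re -
          (ω.expect ({0} : Finset (Site 2)) (nAt 0 (Finset.mem_singleton_self 0) 1)).re) ∈
      Set.Icc ((W - qhi) / δ) ((qlo - W) / δ) :=
  hω.energy_mem_Icc_of_gc_bounds_of_gcGibbs hβ t t' hU μ hz hLs hδ hδβ
    (le_gcPressureTT'Zeeman_of_eventually_gcTorus hβ t t' hU μ hz hL0 hW)
    (gcPressureTT'Zeeman_le_of_eventually_gcTorus (by linarith) t t' hU μ hz hLhi hqhi)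
    (gcPressureTT'Zeeman_le_of_eventually_gcTorus (by linarith) t t' hU μ hz hLlo hqlo)

/-- **THE ENTROPY ROW WITH A FLOOR CERTIFICATE**: a grand-canonical floor `W` at the anchor (eventual form along any
divergent side sequence) gives, for every thermal grand-canonical state at the anchor, every rectangle `B = ∏[0,m_i)`
(`m_i > 0`) and every Hermitian witness `G ∈ 𝔄_B`, the LINEAR row
`(∏ m_i)·(W + β u(ω)) − log Re Tr e^{−G} ≤ Re ω_B(G)`. [cite: Israel1979, Lemma II.3.1] -/
theorem IsTorusLimitOfMixture.mul_add_mul_energy_sub_log_le_re_expect_of_gc_certificate_of_gcGibbs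
    (hω : ω.IsTorusLimitOfMixture sourcedGibbsCount (gcGibbsWeightTT' β t t' U μ hz)
      (gcGibbsVectorTT' t t' U μ hz) Ls)
    (hLs : Tendsto Ls atTop atTop) {W : ℝ} {Lz : ℕ → ℕ} (hL0 : Tendsto Lz atTop atTop)
    (hW : ∀ ε : ℝ, 0 < ε → ∀ᶠ j in atTop,
      (W - ε) * ((Lz j : ℕ) : ℝ) ^ 2 ≤ Real.log (partitionFn β (gcTorusHamiltonianTT' (Lz j) t t' U μ hz)).re)
    {m : Fin 2 → ℕ} (hm : ∀ i, 0 < m i) {G : FermionOp (halfOpenRect m)} (hG : G.IsHermitian) :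
    (∏ i, (m i : ℝ)) * (W + β * (ω.meanEnergy (hubbardTTPrimeFermionInteraction t t' U) 1 - μ * ω.density -
          hz * ((ω.expect ({0} : Finset (Site 2)) (nAt 0 (Finset.mem_singleton_self 0) 0)).re -
            (ω.expect ({0} : Finset (Site 2)) (nAt 0 (Finset.mem_singleton_self 0) 1)).re))) -
        Real.log (partitionFn 1 G).re ≤
      (ω.expect (halfOpenRect m) G).re := by
  have hP : 0 < ∏ i, (m i : ℝ) := Finset.prod_pos fun i _ => by exact_mod_cast hm i
  have hrow := hω.gcPressureTT'Zeeman_add_mul_energy_le_of_gcGibbs_box hβ t t' hU μ hz hLs hm hG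
  have hfloor := le_gcPressureTT'Zeeman_of_eventually_gcTorus hβ t t' hU μ hz hL0 hW
  rw [le_div_iff₀ hP] at hrow
  nlinarith

end Words

end InfVolFermionState

end Literature.MathematicalPhysics.QuantumLattice

end
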